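import Mathlib
import Summits.NavierStokesRegularity.NavierStokesRegularity.Theorems.EulerZoomLiouvillePowerGaugeEulerLiouvilleCondenserMinimalType

/-!
# FINITE EXPONENTIAL TYPE ALONG A SEQUENCE KILLS — THEOREM B with every constant (LEAD 19832 g14, own brick #1)

Width/structure piece for crux `EulerZoomLiouville.PowerGaugeEulerLiouville` (stmt-NavierStokesRegularity-19832), LEAD ns-typeII-p2 g14,
`--supports stmt-NavierStokesRegularity-19832 --as helper`.

THE POINT.  ROUND-42 THEOREM B (`Condenser.selfSimilar_ae_eq_zero_of_minimalTypeGradientC2`, ns-ezl-w2 g3) kills an exactly self-similar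
`C²` member whose gradient has MINIMAL lower exponential type at the clock order `2+ρ` (`∀ c' > 0`, along a sequence of radii,
`sup_{B(0,3R)} ‖DV‖ ≤ exp(c' R^{2+ρ})`); THEOREM K (`…smallTypeGradientC2`, ns-ezl-w2 g4) relaxes `∀ c' > 0` to one `c' < κ(c,ρ)`, and the
R46/R47 K-series of nsreg-p2 pushes the constant.  All these thresholds are `∝ 1/C_E`, `C_E` the constant of the O-FORM ball budget
`∫_{B(0,L)} ‖DV‖² ≤ C_E L^{1−ρ}`.  But the class gives MORE than the O-form: the WEIGHTED E-integral `∫ ‖DV‖² ‖y‖^{ρ−1}` is FINITE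
(`NeedleThinCore.selfSimilar_needle_inputs`), and by dominated convergence the ball budget is then `o(L^{1−ρ})` (T1 below).  Feeding the
o-form into the gauge-form condenser `Condenser.exists_gradient_ge_exp_rpow_of_exit` (t44-B) with `C_E` as small as we please sends every
threshold to `+∞`:

* (T1) `lintegral_fderiv_sq_closedBall_eventually_le` — class-free: `V ∈ C¹`, `ρ < 1`, `∫⁻ ‖DV‖ₑ² · ‖y‖^{ρ−1} ≤ E` ⇒ for every `ε > 0`
  there is `L₀` with `∫⁻_{B̄(0,L)} ‖DV‖ₑ² ≤ ε L^{1−ρ}` for all `L ≥ L₀` (the o-form of `NeedleRace.lintegral_fderiv_sq_closedBall_le`);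
* (T2) `curl_eq_zero_of_typeGradient_le` — the profile-level core of THEOREM B (ns-ezl-w2 g3 `curl_eq_zero_of_minimalTypeGradient`, proof
  VERBATIM) with the E-budget asked only beyond a radius `R_E` and the gradient hypothesis asked at ONE exponent
  `C ≤ πγ²/(256·3^{1−ρ}·C_E)` along a sequence of radii;
* (T3) **`selfSimilar_ae_eq_zero_of_finiteTypeGradientC2`** — MEMBER (crux binders VERBATIM, `0 < ρ ≤ ½`, exact self-similarity about the
  origin, `V ∈ C²`): if for SOME `C` the gradient obeys `sup_{B(0,3R)} ‖DV‖ ≤ exp(C R^{2+ρ})` along an unbounded sequence of radii `R`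
  (FINITE lower exponential type at order `2+ρ` along a sequence), the member is TRIVIAL.  ⊇ THEOREM B, ⊇ THEOREM K, ⊇ sub-critical order.

REGISTERED CONSEQUENCE for THE ONE STATEMENT (LEAD wires `IsKinematicTameProfile` alternative 5): the `C²` needle has INFINITE lower
exponential type at order `2+ρ` — for EVERY `C`, `sup_{B(0,3R)} ‖DV‖ > exp(C R^{2+ρ})` for all large `R`.  (Consistent with the LEAD's kinematic
germ, KINEMATIC-GERM-19832.md lesson (i): finiteness of the weighted E-integral forces the log-range `x^{2+ρ}·λ(x)` with `λ → ∞`.)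

WHAT THIS IS NOT: not NS, not E — a stratum of the crux CLASS (hypothetical blow-up members) on the MODEL lattice; it sharpens the census
(type = ∞), it does not close the needle; 19832 OPEN; NS regularity NOT proved; no summit statement is proved here.
[folklore (dominated convergence; length–area method); setting: ConstantinIgnatovaVicol2026Putative §3.4.1]
-/

noncomputable section

open Set Filter Topology Metric Function MeasureTheory Real
open scoped RealInnerProductSpace NNReal ENNReal

set_option linter.dupNamespace false

namespace Summit.NavierStokesRegularity.NavierStokesRegularity.Theorems.PowerGaugeEulerLiouville.Condenser

open Literature.Analysis Literature.Analysis.FluidPDE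
open Summit.NavierStokesRegularity.NavierStokesRegularity.Theorems.PowerGaugeEulerLiouville

/-! ## (T1) The ball E-budget is `o(L^{1−ρ})` under the finite weighted E-integral -/

/-- **o-FORM OF THE BALL E-BUDGET, integer radii.**  `V ∈ C¹`, `ρ < 1`, `∫⁻ ‖DV‖ₑ²·‖y‖^{ρ−1} ≤ E`: the normalised closed-ball budgets
`(n+1)^{ρ−1} · ∫⁻_{B̄(0,n)} ‖DV‖ₑ²` tend to `0` (dominated convergence: the integrand `1_{B̄(0,n)} ‖DV‖ₑ² (n+1)^{ρ−1}` is dominated by the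
weighted integrand off the origin and tends to `0` pointwise). [folklore] -/
theorem tendsto_lintegral_fderiv_sq_closedBall_mul_rpow {ρ : ℝ} (hρ1 : ρ < 1)
    {V : EuclideanSpace ℝ (Fin 3) → EuclideanSpace ℝ (Fin 3)} (hV : ContDiff ℝ 1 V) {E : ℝ}
    (hE : ∫⁻ y, ‖fderiv ℝ V y‖ₑ ^ 2 * ENNReal.ofReal (‖y‖ ^ (ρ - 1)) ≤ ENNReal.ofReal E) :
    Tendsto (fun n : ℕ => (∫⁻ z in closedBall (0 : EuclideanSpace ℝ (Fin 3)) n, ‖fderiv ℝ V z‖ₑ ^ 2) *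
      ENNReal.ofReal (((n : ℝ) + 1) ^ (ρ - 1))) atTop (𝓝 0) := by
  -- the integrands and the dominating function
  set F : ℕ → EuclideanSpace ℝ (Fin 3) → ℝ≥0∞ := fun n z =>
    (closedBall (0 : EuclideanSpace ℝ (Fin 3)) n).indicator
      (fun z => ‖fderiv ℝ V z‖ₑ ^ 2 * ENNReal.ofReal (((n : ℝ) + 1) ^ (ρ - 1))) z with hF
  set bound : EuclideanSpace ℝ (Fin 3) → ℝ≥0∞ := fun y => ‖fderiv ℝ V y‖ₑ ^ 2 * ENNReal.ofReal (‖y‖ ^ (ρ - 1))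
    with hbound
  have hmeasDV : Measurable fun z : EuclideanSpace ℝ (Fin 3) => ‖fderiv ℝ V z‖ₑ ^ 2 :=
    ((hV.continuous_fderiv one_ne_zero).measurable.enorm).pow_const _
  have hF_meas : ∀ n, Measurable (F n) := fun n =>
    (hmeasDV.mul measurable_const).indicator measurableSet_closedBall
  -- domination off the origin
  have h_bound : ∀ n, F n ≤ᵐ[volume] bound := by
    intro n
    have h0 : ({0}ᶜ : Set (EuclideanSpace ℝ (Fin 3))) ∈ ae (volume : Measure (EuclideanSpace ℝ (Fin 3))) :=
      compl_mem_ae_iff.2 (measure_singleton 0)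
    filter_upwards [h0] with z hz
    simp only [hF, hbound]
    by_cases hzn : z ∈ closedBall (0 : EuclideanSpace ℝ (Fin 3)) n
    · rw [indicator_of_mem hzn]
      have hz0 : 0 < ‖z‖ := norm_pos_iff.2 hz
      have hzn' : ‖z‖ ≤ (n : ℝ) + 1 := (mem_closedBall_zero_iff.1 hzn).trans (by linarith)
      have h1 : ((n : ℝ) + 1) ^ (ρ - 1) ≤ ‖z‖ ^ (ρ - 1) :=
        Real.rpow_le_rpow_of_nonpos hz0 hzn' (by linarith)
      exact mul_le_mul' le_rfl (ENNReal.ofReal_le_ofReal h1)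
    · rw [indicator_of_notMem hzn]
      exact zero_le
  have h_fin : ∫⁻ y, bound y ≠ ∞ := ne_top_of_le_ne_top ENNReal.ofReal_ne_top hE
  -- pointwise limit `0`
  have h_lim : ∀ᵐ z ∂(volume : Measure (EuclideanSpace ℝ (Fin 3))), Tendsto (fun n => F n z) atTop (𝓝 0) := by
    refine Filter.Eventually.of_forall fun z => ?_
    have hpow : Tendsto (fun n : ℕ => ((n : ℝ) + 1) ^ (ρ - 1)) atTop (𝓝 0) := by
      have h1 : Tendsto (fun x : ℝ => x ^ (-(1 - ρ))) atTop (𝓝 0) := tendsto_rpow_neg_atTop (by linarith)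
      have h2 : Tendsto (fun n : ℕ => (n : ℝ) + 1) atTop atTop :=
        tendsto_atTop_add_const_right _ _ tendsto_natCast_atTop_atTop
      have h3 := h1.comp h2
      refine h3.congr fun n => ?_
      simp only [Function.comp_apply, neg_sub]
    have hof : Tendsto (fun n : ℕ => ENNReal.ofReal (((n : ℝ) + 1) ^ (ρ - 1))) atTop (𝓝 0) := by
      have := ENNReal.tendsto_ofReal hpow
      simpa using this
    have hmul : Tendsto (fun n : ℕ => ‖fderiv ℝ V z‖ₑ ^ 2 * ENNReal.ofReal (((n : ℝ) + 1) ^ (ρ - 1))) atTop (𝓝 0) := by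
      have := ENNReal.Tendsto.const_mul hof (Or.inr (by simp : ‖fderiv ℝ V z‖ₑ ^ 2 ≠ ⊤))
      simpa using this
    refine tendsto_of_tendsto_of_tendsto_of_le_of_le tendsto_const_nhds hmul (fun n => zero_le) fun n => ?_
    simp only [hF]
    by_cases hzn : z ∈ closedBall (0 : EuclideanSpace ℝ (Fin 3)) n
    · rw [indicator_of_mem hzn]
    · rw [indicator_of_notMem hzn]
      exact zero_le
  have hconv := tendsto_lintegral_of_dominated_convergence bound hF_meas h_bound h_fin h_lim
  simp only [lintegral_zero] at hconv
  refine hconv.congr fun n => ?_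
  rw [hF, lintegral_indicator measurableSet_closedBall, lintegral_mul_const _ hmeasDV]

/-- **o-FORM OF THE BALL E-BUDGET (real radii).**  `V ∈ C¹`, `ρ < 1`, `∫⁻ ‖DV‖ₑ²·‖y‖^{ρ−1} ≤ E`: for every `ε > 0` there is `L₀` such that
`∫⁻_{B̄(0,L)} ‖DV‖ₑ² ≤ ε·L^{1−ρ}` for all `L ≥ L₀` — the o-form of `NeedleRace.lintegral_fderiv_sq_closedBall_le` (which gives `E·L^{1−ρ}`).
For an exactly self-similar class member the hypothesis is `NeedleThinCore.selfSimilar_needle_inputs`.2. [folklore] -/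
theorem lintegral_fderiv_sq_closedBall_eventually_le {ρ : ℝ} (hρ1 : ρ < 1)
    {V : EuclideanSpace ℝ (Fin 3) → EuclideanSpace ℝ (Fin 3)} (hV : ContDiff ℝ 1 V) {E : ℝ}
    (hE : ∫⁻ y, ‖fderiv ℝ V y‖ₑ ^ 2 * ENNReal.ofReal (‖y‖ ^ (ρ - 1)) ≤ ENNReal.ofReal E)
    {ε : ℝ} (hε : 0 < ε) :
    ∃ L₀ : ℝ, 1 ≤ L₀ ∧ ∀ L : ℝ, L₀ ≤ L →
      ∫⁻ z in closedBall (0 : EuclideanSpace ℝ (Fin 3)) L, ‖fderiv ℝ V z‖ₑ ^ 2 ≤ ENNReal.ofReal (ε * L ^ (1 - ρ)) := by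
  have h3 : 0 < (3 : ℝ) ^ (1 - ρ) := Real.rpow_pos_of_pos (by norm_num) _
  set ε' : ℝ := ε / (3 : ℝ) ^ (1 - ρ) with hε'
  have hε'pos : 0 < ε' := div_pos hε h3
  have ht := tendsto_lintegral_fderiv_sq_closedBall_mul_rpow hρ1 hV hE
  rw [ENNReal.tendsto_nhds_zero] at ht
  obtain ⟨N, hN⟩ := eventually_atTop.1 (ht (ENNReal.ofReal ε') (by simpa using hε'pos))
  refine ⟨max (N : ℝ) 1, le_max_right _ _, fun L hL => ?_⟩
  have hL1 : 1 ≤ L := (le_max_right _ _).trans hL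
  have hLN : (N : ℝ) ≤ L := (le_max_left _ _).trans hL
  have hL0 : 0 < L := by linarith
  -- the integer radius `n = ⌈L⌉₊ ≥ N`, `L ≤ n ≤ L + 1`
  set n : ℕ := ⌈L⌉₊ with hn
  have hLn : L ≤ (n : ℝ) := Nat.le_ceil L
  have hnL : (n : ℝ) < L + 1 := Nat.ceil_lt_add_one hL0.le
  have hNn : N ≤ n := by
    have : (N : ℝ) ≤ (n : ℝ) := hLN.trans hLn
    exact_mod_cast this
  have hI := hN n hNn
  -- un-normalise: `I_n ≤ ε' (n+1)^{1−ρ}`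
  set a : ℝ := ((n : ℝ) + 1) ^ (ρ - 1) with ha
  have hn1 : (0 : ℝ) < (n : ℝ) + 1 := by positivity
  have hapos : 0 < a := Real.rpow_pos_of_pos hn1 _
  have hainv : a⁻¹ = ((n : ℝ) + 1) ^ (1 - ρ) := by
    rw [ha, ← Real.rpow_neg hn1.le, neg_sub]
  have hI' : ∫⁻ z in closedBall (0 : EuclideanSpace ℝ (Fin 3)) n, ‖fderiv ℝ V z‖ₑ ^ 2 ≤
      ENNReal.ofReal (ε' * ((n : ℝ) + 1) ^ (1 - ρ)) := by
    have h1 : (∫⁻ z in closedBall (0 : EuclideanSpace ℝ (Fin 3)) n, ‖fderiv ℝ V z‖ₑ ^ 2) =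
        (∫⁻ z in closedBall (0 : EuclideanSpace ℝ (Fin 3)) n, ‖fderiv ℝ V z‖ₑ ^ 2) * ENNReal.ofReal a * ENNReal.ofReal a⁻¹ := by
      rw [mul_assoc, ← ENNReal.ofReal_mul hapos.le, mul_inv_cancel₀ hapos.ne', ENNReal.ofReal_one, mul_one]
    rw [h1, ← hainv, ENNReal.ofReal_mul hε'pos.le]
    exact mul_le_mul' hI le_rfl
  -- compare radii: `B̄(0,L) ⊆ B̄(0,n)` and `(n+1)^{1−ρ} ≤ (3L)^{1−ρ} = 3^{1−ρ} L^{1−ρ}`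
  have hsub : closedBall (0 : EuclideanSpace ℝ (Fin 3)) L ⊆ closedBall 0 n := closedBall_subset_closedBall hLn
  refine (lintegral_mono_set hsub).trans (hI'.trans (ENNReal.ofReal_le_ofReal ?_))
  have h2 : ((n : ℝ) + 1) ^ (1 - ρ) ≤ (3 * L) ^ (1 - ρ) :=
    Real.rpow_le_rpow hn1.le (by linarith) (by linarith)
  have h3L : (3 * L) ^ (1 - ρ) = (3 : ℝ) ^ (1 - ρ) * L ^ (1 - ρ) := Real.mul_rpow (by norm_num) hL0.le
  calc ε' * ((n : ℝ) + 1) ^ (1 - ρ) ≤ ε' * (3 * L) ^ (1 - ρ) := mul_le_mul_of_nonneg_left h2 hε'pos.le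
    _ = ε * L ^ (1 - ρ) := by rw [h3L, hε']; field_simp

/-! ## (T2) The profile-level core at ONE exponent -/

/-- **PROFILE-LEVEL CORE AT ONE EXPONENT.**  A self-similar Euler profile `(V, P')` with clock `1/(2+ρ)` (`0 < ρ ≤ ½`), `V ∈ C²`, ball
budgets `∫_{B(0,3R)}‖V‖² ≤ C_A(3R)^{1−2ρ}` (`R ≥ 1`) and `∫_{B(0,3R)}‖DV‖² ≤ C_E(3R)^{1−ρ}` (`R ≥ R_E`), whose gradient obeys
`sup_{B(0,3R)} ‖DV‖ ≤ exp(C R^{2+ρ})` along an unbounded sequence of radii for ONE exponent `C ≤ πγ²/(256·3^{1−ρ}C_E)` (`γ = 1/(2+ρ)`), is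
IRROTATIONAL.  Proof = ns-ezl-w2 g3's `curl_eq_zero_of_minimalTypeGradient` verbatim with `c' := κ/2 ≥ C`
(t44-B `exists_gradient_ge_exp_rpow_of_exit` + cut-off no-exit + `Loc.volume_vortical_confined_eq_zero`).
[cite: ConstantinIgnatovaVicol2026Putative, §3.4.1; folklore (length–area method)] -/
theorem curl_eq_zero_of_typeGradient_le {ρ : ℝ} (hρ : 0 < ρ) (hρ1 : ρ ≤ 1 / 2)
    {V : EuclideanSpace ℝ (Fin 3) → EuclideanSpace ℝ (Fin 3)} {P' : EuclideanSpace ℝ (Fin 3) → ℝ}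
    (hprof : IsSelfSimilarEulerProfile (1 / (2 + ρ)) 0 V P') (hV : ContDiff ℝ 2 V)
    {CA CE C RE : ℝ} (hCApos : 0 < CA) (hCEpos : 0 < CE)
    (hbA : ∀ R : ℝ, 1 ≤ R →
      ∫ x in ball (0 : EuclideanSpace ℝ (Fin 3)) (3 * R), ‖V x‖ ^ 2 ≤ CA * (3 * R) ^ (1 - 2 * ρ))
    (hbE : ∀ R : ℝ, RE ≤ R →
      ∫ x in ball (0 : EuclideanSpace ℝ (Fin 3)) (3 * R), ‖fderiv ℝ V x‖ ^ 2 ≤ CE * (3 * R) ^ (1 - ρ))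
    (hC : C ≤ Real.pi * (1 / (2 + ρ)) ^ 2 / (128 * (3 : ℝ) ^ (1 - ρ) * CE) / 2)
    (hgrad : ∀ R₀ : ℝ, ∃ R : ℝ, R₀ ≤ R ∧
      ∀ z ∈ ball (0 : EuclideanSpace ℝ (Fin 3)) (3 * R), ‖fderiv ℝ V z‖ ≤ Real.exp (C * R ^ (2 + ρ))) :
    ∀ x : EuclideanSpace ℝ (Fin 3), curl V x = 0 := by
  have h2ρ : (0 : ℝ) < 2 + ρ := by linarith
  have hγ : (0 : ℝ) < 1 / (2 + ρ) := one_div_pos.2 h2ρ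
  have hγ2 : 1 / (2 + ρ) < 1 / 2 := one_div_lt_one_div_of_lt two_pos (by linarith)
  -- ### THEOREM B in gauge form (t44-B), and the exponent split
  obtain ⟨R₁, hR₁, hB⟩ := exists_gradient_ge_exp_rpow_of_exit (γ := 1 / (2 + ρ)) (ρ := ρ) hγ hρ.le hCApos hCEpos
  set κ : ℝ := Real.pi * (1 / (2 + ρ)) ^ 2 / (128 * (3 : ℝ) ^ (1 - ρ) * CE) with hκ
  have hκpos : 0 < κ := by
    have : 0 < (3 : ℝ) ^ (1 - ρ) := Real.rpow_pos_of_pos (by norm_num) _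
    rw [hκ]; positivity
  set c' : ℝ := κ / 2 with hc'
  have hc'pos : 0 < c' := by positivity
  have hCc' : C ≤ c' := by rw [hc', hκ]; exact hC
  set Rlog : ℝ := 2 * (Real.log (2 / (1 / (2 + ρ))) + 1) / κ with hRlog
  -- ### the profile is irrotational
  intro x
  by_contra hx
  -- a radius handed out by the hypothesis
  obtain ⟨R, hR, hgradR⟩ := hgrad (max (max R₁ (max 1 RE)) (max (‖x‖ + 1) Rlog))
  have hRR₁ : R₁ ≤ R := ((le_max_left _ _).trans (le_max_left _ _)).trans hR
  have hR1 : 1 ≤ R := ((le_max_left _ _).trans ((le_max_right _ _).trans (le_max_left _ _))).trans hR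
  have hRE : RE ≤ R := ((le_max_right _ _).trans ((le_max_right _ _).trans (le_max_left _ _))).trans hR
  have hRx : ‖x‖ + 1 ≤ R := ((le_max_left _ _).trans (le_max_right _ _)).trans hR
  have hRlogR : Rlog ≤ R := ((le_max_right _ _).trans (le_max_right _ _)).trans hR
  have hR0 : 0 < R := by linarith
  -- a `C²` cut-off copy agreeing with `V` on `ball 0 (3R)`
  obtain ⟨Vc, hVc2, -, -, ⟨K, hK⟩, hVU⟩ := Loc.exists_cutoff_local hV (R := 3 * R) (by positivity)
  have hVc1 : ContDiff ℝ 1 Vc := hVc2.of_le (by norm_num)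
  have hfd : ∀ z ∈ ball (0 : EuclideanSpace ℝ (Fin 3)) (3 * R), fderiv ℝ Vc z = fderiv ℝ V z := fun z hz =>
    Filter.EventuallyEq.fderiv_eq (Filter.eventually_of_mem (isOpen_ball.mem_nhds hz) hVU)
  have hAc : ∫ z in ball (0 : EuclideanSpace ℝ (Fin 3)) (3 * R), ‖Vc z‖ ^ 2 ≤ CA * (3 * R) ^ (1 - 2 * ρ) := by
    rw [setIntegral_congr_fun measurableSet_ball (fun z hz => by rw [hVU z hz])]
    exact hbA R hR1
  have hEc : ∫ z in ball (0 : EuclideanSpace ℝ (Fin 3)) (3 * R), ‖fderiv ℝ Vc z‖ ^ 2 ≤ CE * (3 * R) ^ (1 - ρ) := by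
    rw [setIntegral_congr_fun measurableSet_ball (fun z hz => by rw [hfd z hz])]
    exact hbE R hRE
  -- NO EXIT at this scale
  have hnoexit : ∀ y : EuclideanSpace ℝ (Fin 3), ‖y‖ < R → ∀ L : ℝ, 0 ≤ L →
      ‖ODE.evolutionMap (fun _ : ℝ => selfSimilarTransport (1 / (2 + ρ)) 0 Vc) 0 (-L) y‖ < 2 * R := by
    intro y hy L hL
    by_contra hex
    push Not at hex
    obtain ⟨z, hz, hzle⟩ := hB Vc K hVc1 hK R hRR₁ hAc hEc y L hL hy hex
    rw [hfd z hz] at hzle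
    have hCR : Real.exp (C * R ^ (2 + ρ)) ≤ Real.exp (c' * R ^ (2 + ρ)) :=
      Real.exp_le_exp.2 (mul_le_mul_of_nonneg_right hCc' (Real.rpow_nonneg hR0.le _))
    have h1 := hzle.trans ((hgradR z hz).trans hCR)
    -- `γ/2 · e^{κ R^{2+ρ}} ≤ e^{(κ/2) R^{2+ρ}}` is impossible for `R ≥ Rlog`
    have hRpow : R ≤ R ^ (2 + ρ) := by
      have : R ^ (1 : ℝ) ≤ R ^ (2 + ρ) := Real.rpow_le_rpow_of_exponent_le hR1 (by linarith)
      rwa [Real.rpow_one] at this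
    have h2 : Real.log (2 / (1 / (2 + ρ))) + 1 ≤ c' * R ^ (2 + ρ) := by
      have h3 : Real.log (2 / (1 / (2 + ρ))) + 1 = c' * Rlog := by
        rw [hc', hRlog]; field_simp
      rw [h3]
      exact mul_le_mul_of_nonneg_left (hRlogR.trans hRpow) hc'pos.le
    have hκc : κ = c' + c' := by rw [hc']; ring
    have h4 : 1 / (2 + ρ) / 2 * Real.exp (κ * R ^ (2 + ρ)) =
        (1 / (2 + ρ) / 2 * Real.exp (c' * R ^ (2 + ρ))) * Real.exp (c' * R ^ (2 + ρ)) := by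
      rw [hκc, add_mul, Real.exp_add]; ring
    rw [h4] at h1
    have h5 : 1 / (2 + ρ) / 2 * Real.exp (c' * R ^ (2 + ρ)) ≤ 1 :=
      le_of_mul_le_mul_right (by simpa using h1) (Real.exp_pos _)
    -- but `e^{c' R^{2+ρ}} ≥ e · (2/γ)`
    have h6 : Real.exp (Real.log (2 / (1 / (2 + ρ))) + 1) ≤ Real.exp (c' * R ^ (2 + ρ)) := Real.exp_le_exp.2 h2
    rw [Real.exp_add, Real.exp_log (by positivity)] at h6
    have h7 : (1 : ℝ) < Real.exp 1 := by
      have := Real.add_one_lt_exp (by norm_num : (1 : ℝ) ≠ 0)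
      linarith
    have hγ' : 0 < 1 / (2 + ρ) / 2 := by positivity
    have h8 : 1 / (2 + ρ) / 2 * (2 / (1 / (2 + ρ)) * Real.exp 1) ≤
        1 / (2 + ρ) / 2 * Real.exp (c' * R ^ (2 + ρ)) := mul_le_mul_of_nonneg_left h6 hγ'.le
    have h9 : 1 / (2 + ρ) / 2 * (2 / (1 / (2 + ρ)) * Real.exp 1) = Real.exp 1 := by
      field_simp
    linarith
  -- CONFINEMENT: every vortical point of `B(0,R)` has a backward `V`-trajectory staying in `B̄(0,2R)`
  have hnull := Loc.volume_vortical_confined_eq_zero hprof hγ hγ2 (N := 2 * R) (by positivity)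
  set O : Set (EuclideanSpace ℝ (Fin 3)) := ball 0 R ∩ {x' | curl V x' ≠ 0} with hO
  have hOopen : IsOpen O :=
    isOpen_ball.inter (isOpen_ne_fun (differentiable_curl_of_contDiff hV).continuous continuous_const)
  have hxO : x ∈ O := ⟨mem_ball_zero_iff.2 (by linarith), hx⟩
  have hOsub : O ⊆ {x' : EuclideanSpace ℝ (Fin 3) | curl V x' ≠ 0 ∧
      ∃ Y : ℝ → EuclideanSpace ℝ (Fin 3), Y 0 = x' ∧
        (∀ t, 0 ≤ t → HasDerivAt Y ((-1 : ℝ) • selfSimilarTransport (1 / (2 + ρ)) 0 V (Y t)) t) ∧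
        ∀ t, 0 ≤ t → ‖Y t‖ ≤ 2 * R} := by
    rintro x' ⟨hx'R, hx'c⟩
    refine ⟨hx'c, fun t => ODE.evolutionMap (fun _ : ℝ => selfSimilarTransport (1 / (2 + ρ)) 0 Vc) 0 (-t) x',
      ?_, ?_, ?_⟩
    · simp [ODE.evolutionMap_self]
    · intro t ht
      have h := C2.Kelvin.hasDerivAt_flow_neg (γ := 1 / (2 + ρ)) hVc1 hK x' t
      have hin : ODE.evolutionMap (fun _ : ℝ => selfSimilarTransport (1 / (2 + ρ)) 0 Vc) 0 (-t) x' ∈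
          ball (0 : EuclideanSpace ℝ (Fin 3)) (3 * R) :=
        mem_ball_zero_iff.2 ((hnoexit x' (mem_ball_zero_iff.1 hx'R) t ht).trans (by linarith))
      have hW : selfSimilarTransport (1 / (2 + ρ)) 0 Vc
            (ODE.evolutionMap (fun _ : ℝ => selfSimilarTransport (1 / (2 + ρ)) 0 Vc) 0 (-t) x') =
          selfSimilarTransport (1 / (2 + ρ)) 0 V
            (ODE.evolutionMap (fun _ : ℝ => selfSimilarTransport (1 / (2 + ρ)) 0 Vc) 0 (-t) x') := by
        rw [selfSimilarTransport_apply, selfSimilarTransport_apply, hVU _ hin]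
      rw [hW] at h
      exact h
    · intro t ht
      exact (hnoexit x' (mem_ball_zero_iff.1 hx'R) t ht).le
  have hO0 : volume O = 0 := measure_mono_null hOsub hnull
  exact (hOopen.measure_pos volume ⟨x, hxO⟩).ne' hO0

/-! ## (T3) The member: finite lower exponential type along a sequence kills -/

/-- **FINITE EXPONENTIAL TYPE AT THE CRITICAL ORDER ALONG A SEQUENCE KILLS** — THEOREM B with every constant.  An exactly self-similar
`C²` member of the crux class (crux binders VERBATIM, `γ = 1/(2+ρ)`, `0 < ρ ≤ ½`) whose profile gradient obeys, for SOME `C`,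
`sup_{B(0,3R)} ‖DV‖ ≤ exp(C R^{2+ρ})` along an unbounded sequence of radii (`liminf_R R^{−(2+ρ)} log sup_{B(0,3R)}‖DV‖ < ∞`) is TRIVIAL.
Route: (T1) o-form of the E-budget from `NeedleThinCore.selfSimilar_needle_inputs`.2, fed into (T2) with `C_E := πγ²/(256·3^{1−ρ}·max C 1)`;
conclusion by `Loc.selfSimilar_ae_eq_zero_of_irrotationalC2_profile`.  ⊇ THEOREM B (`…minimalTypeGradientC2`) ⊇ THEOREM K (`…smallTypeGradientC2`).
[cite: ConstantinIgnatovaVicol2026Putative, §3.4.1; folklore (dominated convergence, length–area method)] -/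
theorem selfSimilar_ae_eq_zero_of_finiteTypeGradientC2 {ρ : ℝ} (hρ : 0 < ρ) (hρ1 : ρ ≤ 1 / 2)
    {u : ℝ → EuclideanSpace ℝ (Fin 3) → EuclideanSpace ℝ (Fin 3)} {p : ℝ → EuclideanSpace ℝ (Fin 3) → ℝ}
    {H : ℝ → EuclideanSpace ℝ (Fin 3) → EuclideanSpace ℝ (Fin 3) →L[ℝ] EuclideanSpace ℝ (Fin 3)} {c : ℝ≥0}
    (hsw : IsSuitableWeakSolutionOn (slab (EuclideanSpace ℝ (Fin 3)) (Iio 0) isOpen_Iio) 0 0 u p)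
    (hH : HasWeakSpatialGradientOn (slab (EuclideanSpace ℝ (Fin 3)) (Iio 0) isOpen_Iio) u H)
    (hgauge : ∀ a : ℝ, 0 < a →
      ENNReal.ofReal (a ^ (2 * ρ)) * cknA a (0 : ℝ × EuclideanSpace ℝ (Fin 3)) u +
          ENNReal.ofReal (a ^ ρ) * cknE a (0 : ℝ × EuclideanSpace ℝ (Fin 3)) H +
        ENNReal.ofReal (a ^ (2 * ρ)) * cknD a (0 : ℝ × EuclideanSpace ℝ (Fin 3)) p ≤ (c : ℝ≥0∞))
    {V : EuclideanSpace ℝ (Fin 3) → EuclideanSpace ℝ (Fin 3)} {P : EuclideanSpace ℝ (Fin 3) → ℝ}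
    (hu : ∀ τ : ℝ, τ < 0 → u τ = selfSimilarCollapse (1 / (2 + ρ)) 0 V τ)
    (hp : ∀ τ : ℝ, τ < 0 → p τ = selfSimilarCollapsePressure (1 / (2 + ρ)) 0 P τ)
    (hV : ContDiff ℝ 2 V)
    (hgrad : ∃ C : ℝ, ∀ R₀ : ℝ, ∃ R : ℝ, R₀ ≤ R ∧
      ∀ z ∈ ball (0 : EuclideanSpace ℝ (Fin 3)) (3 * R), ‖fderiv ℝ V z‖ ≤ Real.exp (C * R ^ (2 + ρ))) :
    uncurry u =ᵐ[volume.restrict (Iio (0 : ℝ) ×ˢ (univ : Set (EuclideanSpace ℝ (Fin 3))))] 0 := by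
  have hρ1' : ρ < 1 := by linarith
  have h2ρ : (0 : ℝ) < 2 + ρ := by linarith
  have hV1 : ContDiff ℝ 1 V := hV.of_le (by norm_num)
  obtain ⟨C, hgradC⟩ := hgrad
  -- WLOG `C ≥ 1`
  set C₁ : ℝ := max C 1 with hC₁
  have hC₁pos : 0 < C₁ := lt_of_lt_of_le one_pos (le_max_right _ _)
  have hgrad₁ : ∀ R₀ : ℝ, ∃ R : ℝ, R₀ ≤ R ∧
      ∀ z ∈ ball (0 : EuclideanSpace ℝ (Fin 3)) (3 * R), ‖fderiv ℝ V z‖ ≤ Real.exp (C₁ * R ^ (2 + ρ)) := by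
    intro R₀
    obtain ⟨R, hR, h⟩ := hgradC (max R₀ 0)
    refine ⟨R, (le_max_left _ _).trans hR, fun z hz => (h z hz).trans (Real.exp_le_exp.2 ?_)⟩
    exact mul_le_mul_of_nonneg_right (le_max_left _ _) (Real.rpow_nonneg ((le_max_right _ _).trans hR) _)
  -- ### a classical pressure for the profile
  have hA : ∀ a : ℝ, 0 < a → ENNReal.ofReal (a ^ (2 * ρ)) *
      cknA a (0 : ℝ × EuclideanSpace ℝ (Fin 3)) u ≤ (c : ℝ≥0∞) :=
    fun a ha => le_trans (le_trans le_self_add le_self_add) (hgauge a ha)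
  have hD : ∀ a : ℝ, 0 < a → ENNReal.ofReal (a ^ (2 * ρ)) *
      cknD a (0 : ℝ × EuclideanSpace ℝ (Fin 3)) p ≤ (c : ℝ≥0∞) :=
    fun a ha => le_trans le_add_self (hgauge a ha)
  have hpm : AEStronglyMeasurable (uncurry p)
      (volume.restrict (Iio (0 : ℝ) ×ˢ (univ : Set (EuclideanSpace ℝ (Fin 3))))) := by
    have := hsw.distributional.2.2.1.aestronglyMeasurable
    simpa [slab] using this
  have hPm := aestronglyMeasurable_pressureProfile hpm hp
  have hDprof := profile_pressure_weight_of_gaugeD hρ hρ1' hpm hp hD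
  have hP1 : LocallyIntegrable P volume :=
    EnergySaturation.locallyIntegrable_pressure_of_weight hρ1' hPm
      (ENNReal.mul_ne_top ENNReal.ofReal_ne_top ENNReal.coe_ne_top) hDprof
  obtain ⟨P', hprof⟩ :=
    WeakToClassical.exists_isSelfSimilarEulerProfile_of_contDiff hsw.distributional hu hp hV hP1
  -- ### the class budgets of the profile: A in O-form, E in o-FORM (T1)
  obtain ⟨hA', hE'⟩ :=
    NeedleThinCore.selfSimilar_needle_inputs hρ hρ1' hsw hH hgauge hu hp hV1
  set CA : ℝ := (c : ℝ) + 1 with hCA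
  have hCApos : 0 < CA := by positivity
  have hbA : ∀ R : ℝ, 1 ≤ R →
      ∫ x in ball (0 : EuclideanSpace ℝ (Fin 3)) (3 * R), ‖V x‖ ^ 2 ≤ CA * (3 * R) ^ (1 - 2 * ρ) := by
    intro R hR
    have h3R0 : (0 : ℝ) < 3 * R := by linarith
    have hX : 0 ≤ CA * (3 * R) ^ (1 - 2 * ρ) := by positivity
    refine setIntegral_sq_le_of_lintegral hV.continuous hX ((hA' (3 * R) h3R0).trans ?_)
    rw [hCA, ← ENNReal.ofReal_coe_nnreal, ← ENNReal.ofReal_mul (NNReal.coe_nonneg c)]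
    exact ENNReal.ofReal_le_ofReal (by nlinarith [Real.rpow_nonneg h3R0.le (1 - 2 * ρ), NNReal.coe_nonneg c])
  -- the E-constant as small as the exponent `C₁` demands
  have h3 : 0 < (3 : ℝ) ^ (1 - ρ) := Real.rpow_pos_of_pos (by norm_num) _
  set CE : ℝ := Real.pi * (1 / (2 + ρ)) ^ 2 / (256 * (3 : ℝ) ^ (1 - ρ) * C₁) with hCE
  have hCEpos : 0 < CE := by
    have : 0 < Real.pi := Real.pi_pos
    rw [hCE]; positivity
  have hCκ : C₁ ≤ Real.pi * (1 / (2 + ρ)) ^ 2 / (128 * (3 : ℝ) ^ (1 - ρ) * CE) / 2 := by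
    rw [hCE]
    have hπ : 0 < Real.pi := Real.pi_pos
    have hγ2 : 0 < (1 / (2 + ρ)) ^ 2 := by positivity
    rw [show Real.pi * (1 / (2 + ρ)) ^ 2 / (128 * (3 : ℝ) ^ (1 - ρ) *
        (Real.pi * (1 / (2 + ρ)) ^ 2 / (256 * (3 : ℝ) ^ (1 - ρ) * C₁))) / 2 = C₁ by
      field_simp; ring]
  obtain ⟨L₀, hL₀1, hL₀⟩ := lintegral_fderiv_sq_closedBall_eventually_le hρ1' hV1 hE' hCEpos
  have hbE : ∀ R : ℝ, L₀ ≤ R →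
      ∫ x in ball (0 : EuclideanSpace ℝ (Fin 3)) (3 * R), ‖fderiv ℝ V x‖ ^ 2 ≤ CE * (3 * R) ^ (1 - ρ) := by
    intro R hR
    have hR1 : 1 ≤ R := hL₀1.trans hR
    have h3R : L₀ ≤ 3 * R := by linarith
    have h3R0 : (0 : ℝ) < 3 * R := by linarith
    have h1 := hL₀ (3 * R) h3R
    have h2 : ∫⁻ z in ball (0 : EuclideanSpace ℝ (Fin 3)) (3 * R), ‖fderiv ℝ V z‖ₑ ^ 2 ≤
        ENNReal.ofReal (CE * (3 * R) ^ (1 - ρ)) :=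
      (lintegral_mono_set ball_subset_closedBall).trans h1
    have hY : 0 ≤ CE * (3 * R) ^ (1 - ρ) := by positivity
    exact setIntegral_sq_le_of_lintegral (hV.continuous_fderiv (by norm_num)) hY h2
  -- ### (T2): the profile is irrotational; conclusion
  have hcurl : ∀ x : EuclideanSpace ℝ (Fin 3), curl V x = 0 :=
    curl_eq_zero_of_typeGradient_le hρ hρ1 hprof hV hCApos hCEpos hbA hbE hCκ hgrad₁
  exact Loc.selfSimilar_ae_eq_zero_of_irrotationalC2_profile hρ hsw.distributional hA hu hV hcurl

end Summit.NavierStokesRegularity.NavierStokesRegularity.Theorems.PowerGaugeEulerLiouville.Condenser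

end
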